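import Mathlib
import Literature.NumberTheory.ComplexMultiplication.ReflexType
import HarnessLib

/-!
# Sextic CM fields: the hyperoctahedral group `W(B₃) ≤ 𝔖₆`, sign changes, and primitivity of all CM types

For a CM field `K` of degree `2n` with Galois closure `L`, `Gal(L/ℚ)` acts faithfully on the `2n` embeddings
`Hom(K, ℂ)`, complex conjugation `ρ` is CENTRAL, and the action preserves the `n` conjugate pairs: `Gal(L/ℚ)` is an
imprimitive permutation group inside `(ℤ/2)ⁿ ⋊ 𝔖ₙ` (Dodson 1984, §1.1 "Imprimitivity Theorem", p. 3).  This file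
is the finite group theory of the case `n = 3` (sextic CM fields), entirely inside `Equiv.Perm (Fin 6)` and
decided by `decide`:

* the model: `Fin 6 = Hom(K, ℂ)` with `a ↦ a + 3` = complex conjugation `cc`; `W = C_{𝔖₆}(cc) = W(B₃)`
  (`card_W : Nat.card W = 48`), the sign changes `f0 f1 f2`, the rotation `rot`, pair transpositions `s01 s02 s12`;
* **`flips_mem`, `rot_mem`, `eq_W_of_card`, `coe_eq_words_of_card`** — a subgroup `𝒢 ≤ W` containing `cc` of
  order `24` or `48` contains all three sign changes and the rotation; it is `W` itself (order `48`) or exactly the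
  `24` words `f0^a f1^b f2^c rot^k = (ℤ/2)³ ⋊ ℤ/3` (order `24`) — the two ρ-structures `(ℤ₂)³ ⋊ G₀`, `G₀ = 𝔖₃, ℤ₃`,
  of Dodson's list for `n = 3` (§5.1.2 Theorem, p. 20; the other two, `ℤ₂ × G₀`, have orders `6`, `12`);
* **`no_index_two_over_stab`** — for such `𝒢` no index-two subgroup contains the stabiliser of a point ("`K`
  contains no imaginary quadratic field", by the Galois correspondence); `card_stab_W` (`|Stab_W(0)| = 8`);
* CM types as finsets `Φ ⊆ Fin 6` with `a ∈ Φ ↔ cc a ∉ Φ` (`IsCMType`); **`rstab_iff_fix`** — if `f1, f2 ∈ 𝒢` then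
  for a CM type `Φ ∋ 0` and any `u`: `(∀ x ∈ 𝒢, (x u) 0 ∈ Φ ↔ x 0 ∈ Φ) ↔ u 0 = 0`; hence, in the vocabulary of
  `ReflexType.lean` (Shimura's criterion `isPrimitive_iff`), **`isPrimitive_of_flips` / `isPrimitive_of_card`:
  every CM type of such a sextic CM field is PRIMITIVE**, and the stabiliser of its reflex lift is the stabiliser
  of the base embedding (`stabilizer_reflexLift_eq_of_card`: "`H' = H`", the reflex field of the reflex is `K`).

## Method

Pure computation in `𝔖₆` (`decide`, two `maxRecDepth` bumps for the 48-word count) plus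
`Subgroup.mul_self_mem_of_index_two` (index-two subgroups contain all squares) and cardinality bookkeeping.

## References

* B. Dodson, *The structure of Galois groups of CM-fields*, Trans. AMS 283 (1984) 1–32 [Dodson1984], §1.1
  Imprimitivity Theorem (p. 3), §5.1.2 Theorem and §5.1.3 Prop. 1 (p. 20, `n = 3`).
* G. Shimura, *Abelian varieties with complex multiplication and modular functions* (1998) [Shimura1998], §8.2
  Prop. 26 (primitivity criterion `H₁ = H'`), via `Literature.NumberTheory.ComplexMultiplication.isPrimitive_iff`.

## Provenance

Staged by the pub-hodgecm formalisation cell (DAG-node prover #01 lineage) under the LEAN-IN-TREE rule; it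
supersedes the Mathlib-only part of the cell's standalone package file `HodgeCM/PerL34/GaloisB3.lean` (namespace
`HodgeCM.PerL34.GaloisB3` ↦ `Literature.NumberTheory.ComplexMultiplication.SexticB3`, same short names), with the
primitivity consequence restated over the tree's `IsPrimitive` instead of a ported right-stabiliser subgroup.

## Not here

The Galois theory identifying `Gal(L/ℚ)` with such a `𝒢` (faithfulness on `Hom(K,ℂ)`, centrality of `ρ`,
`|Gal(L/ℚ)| = [L:ℚ]`); CM types of `K` versus abelian varieties.
-/

set_option autoImplicit false

namespace Literature.NumberTheory.ComplexMultiplication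

namespace SexticB3

open Equiv
open scoped Pointwise

/-! ### The model: `W(B₃) = C_{𝔖₆}(cc)` -/

/-- Sign change at the first place: `φ₁ ↔ ρφ₁`. [folklore] -/
def f0 : Perm (Fin 6) := swap 0 3
/-- Sign change at the second place. [folklore] -/
def f1 : Perm (Fin 6) := swap 1 4
/-- Sign change at the third place. [folklore] -/
def f2 : Perm (Fin 6) := swap 2 5
/-- Complex conjugation on the six embeddings: `i ↦ i + 3`. [folklore] -/
def cc : Perm (Fin 6) := f0 * f1 * f2
/-- The rotation of the three places (a lift of the `3`-cycle of `𝔖₃`). [folklore] -/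
def rot : Perm (Fin 6) := swap 0 1 * swap 1 2 * swap 3 4 * swap 4 5
/-- The transposition of places `2` and `3` (fixing the first place pointwise). [folklore] -/
def s12 : Perm (Fin 6) := swap 1 2 * swap 4 5
/-- The transposition of places `1` and `3`. [folklore] -/
def s02 : Perm (Fin 6) := swap 0 2 * swap 3 5
/-- The transposition of places `1` and `2`. [folklore] -/
def s01 : Perm (Fin 6) := swap 0 1 * swap 3 4

/-- `cc i = i + 3`. [folklore] -/
theorem cc_apply (i : Fin 6) : cc i = i + 3 := by revert i; decide

/-- `cc` is an involution. [folklore] -/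
theorem cc_mul_cc : cc * cc = 1 := by decide

/-- `W(B₃) = Im(3,2)`: the permutations of the six embeddings commuting with complex conjugation, i.e. preserving
the three conjugate pairs. [cite: Dodson1984, §1.1 Imprimitivity Theorem] -/
def W : Subgroup (Perm (Fin 6)) where
  carrier := {g | g * cc = cc * g}
  one_mem' := by simp
  mul_mem' := by
    intro a b ha hb
    simp only [Set.mem_setOf_eq] at ha hb ⊢
    rw [mul_assoc, hb, ← mul_assoc, ha, mul_assoc]
  inv_mem' := by
    intro a ha
    simp only [Set.mem_setOf_eq] at ha ⊢
    have h : a⁻¹ * (a * cc) * a⁻¹ = a⁻¹ * (cc * a) * a⁻¹ := by rw [ha]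
    rw [← mul_assoc, inv_mul_cancel, one_mul, mul_assoc, mul_assoc, mul_inv_cancel, mul_one] at h
    exact h.symm

/-- Membership in `W`, definitionally. [folklore] -/
theorem mem_W {g : Perm (Fin 6)} : g ∈ W ↔ g * cc = cc * g := Iff.rfl

/-- Membership in `W` is decidable (commutation with `cc`). [folklore] -/
instance : DecidablePred (· ∈ W) := fun g => decidable_of_iff (g * cc = cc * g) mem_W.symm

/-- `|W(B₃)| = 2³ · 3! = 48`. [cite: Dodson1984, §1.1 Imprimitivity Theorem] -/
theorem card_W : Nat.card W = 48 := by
  rw [Nat.card_eq_fintype_card]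
  decide

/-- [folklore] -/
theorem cc_mem_W : cc ∈ W := by decide
/-- [folklore] -/
theorem f0_mem_W : f0 ∈ W := by decide
/-- [folklore] -/
theorem f1_mem_W : f1 ∈ W := by decide
/-- [folklore] -/
theorem f2_mem_W : f2 ∈ W := by decide
/-- [folklore] -/
theorem rot_mem_W : rot ∈ W := by decide
/-- [folklore] -/
theorem s12_mem_W : s12 ∈ W := by decide
/-- [folklore] -/
theorem s02_mem_W : s02 ∈ W := by decide
/-- [folklore] -/
theorem s01_mem_W : s01 ∈ W := by decide

/-- `cc` is central in `W` (by definition of `W`). [folklore] -/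
theorem cc_central {g : Perm (Fin 6)} (hg : g ∈ W) : g * cc = cc * g := hg

/-! ### Subgroups of order `24` or `48` containing `cc` contain the sign changes -/

/-- [folklore] -/
theorem f0_eq : f0 = cc * ((f1 * s12) * (f1 * s12)) := by decide
/-- [folklore] -/
theorem f1_eq : f1 = cc * ((f0 * s02) * (f0 * s02)) := by decide
/-- [folklore] -/
theorem f2_eq : f2 = cc * ((f0 * s01) * (f0 * s01)) := by decide

/-- In a subgroup `𝒢 ≤ W(B₃)` of order `24` or `48`, every square of `W(B₃)` lies in `𝒢` (index `≤ 2`).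
[folklore] -/
theorem sq_mem (𝒢 : Subgroup (Perm (Fin 6))) (hW : 𝒢 ≤ W) (hcard : Nat.card 𝒢 = 24 ∨ Nat.card 𝒢 = 48)
    {w : Perm (Fin 6)} (hw : w ∈ W) : w * w ∈ 𝒢 := by
  rcases hcard with h24 | h48
  · have hidx : (𝒢.subgroupOf W).index = 2 := by
      have h1 := (𝒢.subgroupOf W).card_mul_index
      have h2 : Nat.card (𝒢.subgroupOf W) = 24 := by
        rw [Nat.card_congr (Subgroup.subgroupOfEquivOfLe hW).toEquiv]; exact h24
      rw [h2, card_W] at h1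
      omega
    have h := Subgroup.mul_self_mem_of_index_two hidx ⟨w, hw⟩
    rw [Subgroup.mem_subgroupOf] at h
    exact h
  · have hEq : 𝒢 = W := Subgroup.eq_of_le_of_card_ge hW (by rw [h48, card_W])
    rw [hEq]
    exact W.mul_mem hw hw

/-- A subgroup `𝒢 ≤ W(B₃)` containing complex conjugation and of order `24` or `48` contains the three sign
changes: `𝒢 ∩ (ℤ/2)³ = (ℤ/2)³` (Dodson: for `n = 3` the ρ-structures of these orders are `(ℤ₂)³ ⋊ G₀`).
[cite: Dodson1984, §5.1.2 Theorem] -/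
theorem flips_mem (𝒢 : Subgroup (Perm (Fin 6))) (hW : 𝒢 ≤ W) (hc : cc ∈ 𝒢)
    (hcard : Nat.card 𝒢 = 24 ∨ Nat.card 𝒢 = 48) : f0 ∈ 𝒢 ∧ f1 ∈ 𝒢 ∧ f2 ∈ 𝒢 := by
  refine ⟨?_, ?_, ?_⟩
  · rw [f0_eq]; exact 𝒢.mul_mem hc (sq_mem 𝒢 hW hcard (W.mul_mem f1_mem_W s12_mem_W))
  · rw [f1_eq]; exact 𝒢.mul_mem hc (sq_mem 𝒢 hW hcard (W.mul_mem f0_mem_W s02_mem_W))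
  · rw [f2_eq]; exact 𝒢.mul_mem hc (sq_mem 𝒢 hW hcard (W.mul_mem f0_mem_W s01_mem_W))

/-- The rotation of places also lies in every such `𝒢` (`rot = (rot²)²` and `rot²` is a square). [folklore] -/
theorem rot_mem (𝒢 : Subgroup (Perm (Fin 6))) (hW : 𝒢 ≤ W) (hcard : Nat.card 𝒢 = 24 ∨ Nat.card 𝒢 = 48) :
    rot ∈ 𝒢 := by
  have h : rot = (rot * rot) * (rot * rot) := by decide
  rw [h]
  exact 𝒢.mul_mem (sq_mem 𝒢 hW hcard rot_mem_W) (sq_mem 𝒢 hW hcard rot_mem_W)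

/-! ### CM types and the primitivity computation -/

/-- `Φ ⊆ Hom(K,ℂ) = Fin 6` is a CM type: exactly one of each conjugate pair. [folklore] -/
def IsCMType (Φ : Finset (Fin 6)) : Prop := ∀ a : Fin 6, a ∈ Φ ↔ cc a ∉ Φ

/-- Being a CM type is decidable. [folklore] -/
instance : DecidablePred IsCMType := fun Φ => by unfold IsCMType; infer_instance

/-- The finite heart: a member of a CM type `Φ ∋ 0` whose images under both sign changes `f1, f2` stay in `Φ`
is the base point `0`. [folklore] -/
theorem eq_zero_of_flips (Φ : Finset (Fin 6)) (hΦ : IsCMType Φ) (h0 : (0 : Fin 6) ∈ Φ) (y : Fin 6)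
    (hy : y ∈ Φ) (h1 : f1 y ∈ Φ) (h2 : f2 y ∈ Φ) : y = 0 := by
  revert y; revert Φ; decide

/-- **Right stabiliser of the lifted type = stabiliser of the base point.**  If `𝒢 ∋ f1, f2`, then for a CM type
`Φ ∋ 0` and any permutation `u`: `u` right-stabilises `{x ∈ 𝒢 | x 0 ∈ Φ}` iff `u 0 = 0`. [folklore] -/
theorem rstab_iff_fix {𝒢 : Subgroup (Perm (Fin 6))} (h1 : f1 ∈ 𝒢) (h2 : f2 ∈ 𝒢)
    {Φ : Finset (Fin 6)} (hΦ : IsCMType Φ) (h0 : (0 : Fin 6) ∈ Φ) (u : Perm (Fin 6)) :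
    (∀ x ∈ 𝒢, (x * u) 0 ∈ Φ ↔ x 0 ∈ Φ) ↔ u 0 = 0 := by
  constructor
  · intro h
    have a := (h 1 𝒢.one_mem).mpr (by simpa using h0)
    have e1 : f1 0 = 0 := by decide
    have e2 : f2 0 = 0 := by decide
    have b := (h f1 h1).mpr (by rw [e1]; exact h0)
    have c := (h f2 h2).mpr (by rw [e2]; exact h0)
    simp only [Perm.mul_apply, Perm.one_apply] at a b c
    exact eq_zero_of_flips Φ hΦ h0 (u 0) a b c
  · intro hu x _
    simp [Perm.mul_apply, hu]

/-- **Every CM type is primitive** (Shimura's sense, `IsPrimitive` of `ReflexType.lean`, for the group `𝒢` acting on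
`Fin 6 = Hom(K,ℂ)` with base embedding `0`) as soon as `𝒢` contains the sign changes `f1, f2`.
[cite: Shimura1998, §8.2 Prop. 26] -/
theorem isPrimitive_of_flips {𝒢 : Subgroup (Perm (Fin 6))} (h1 : f1 ∈ 𝒢) (h2 : f2 ∈ 𝒢)
    {Φ : Finset (Fin 6)} (hΦ : IsCMType Φ) (h0 : (0 : Fin 6) ∈ Φ) :
    IsPrimitive 𝒢 (↑Φ : Set (Fin 6)) (0 : Fin 6) := by
  intro H _ hH u hu
  rw [MulAction.mem_stabilizer_iff, Subgroup.smul_def, Perm.smul_def]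
  have key : ∀ x ∈ 𝒢, (x * (u : Perm (Fin 6))) 0 ∈ Φ ↔ x 0 ∈ Φ := by
    intro x hx
    have h := hH u hu ⟨x, hx⟩
    simpa only [mem_typeLift, Subgroup.smul_def, Perm.smul_def, Subgroup.coe_mul, Finset.mem_coe,
      Perm.mul_apply] using h
  exact (rstab_iff_fix h1 h2 hΦ h0 (u : Perm (Fin 6))).1 key

/-- **All eight CM types of a sextic CM field with `|Gal(L/ℚ)| ∈ {24, 48}` are primitive** (in the model:
`𝒢 ≤ W`, `cc ∈ 𝒢`, `|𝒢| ∈ {24, 48}`, any CM type `Φ ∋ 0`). [cite: Dodson1984, §5.1.3 Prop. 1] -/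
theorem isPrimitive_of_card (𝒢 : Subgroup (Perm (Fin 6))) (hW : 𝒢 ≤ W) (hc : cc ∈ 𝒢)
    (hcard : Nat.card 𝒢 = 24 ∨ Nat.card 𝒢 = 48) {Φ : Finset (Fin 6)} (hΦ : IsCMType Φ) (h0 : (0 : Fin 6) ∈ Φ) :
    IsPrimitive 𝒢 (↑Φ : Set (Fin 6)) (0 : Fin 6) :=
  isPrimitive_of_flips (flips_mem 𝒢 hW hc hcard).2.1 (flips_mem 𝒢 hW hc hcard).2.2 hΦ h0

/-- Consequently "`H' = H`": the stabiliser in `𝒢` of the reflex lift `{g | g⁻¹ 0 ∈ Φ}` is the stabiliser of the base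
embedding (the reflex field of the reflex type is `K` itself). [cite: Shimura1998, §8.2 Prop. 26] -/
theorem stabilizer_reflexLift_eq_of_card (𝒢 : Subgroup (Perm (Fin 6))) (hW : 𝒢 ≤ W) (hc : cc ∈ 𝒢)
    (hcard : Nat.card 𝒢 = 24 ∨ Nat.card 𝒢 = 48) {Φ : Finset (Fin 6)} (hΦ : IsCMType Φ) (h0 : (0 : Fin 6) ∈ Φ) :
    MulAction.stabilizer 𝒢 (reflexLift (↑Φ : Set (Fin 6)) (0 : Fin 6) : Set 𝒢) =
      MulAction.stabilizer 𝒢 (0 : Fin 6) :=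
  (isPrimitive_of_card 𝒢 hW hc hcard hΦ h0).stabilizer_reflexLift_eq

/-! ### No index-two subgroup above the stabiliser ("no imaginary quadratic subfield") -/

/-- The words `f0^a f1^b f2^c rot^k`. [folklore] -/
def word (v : Fin 2 × Fin 2 × Fin 2 × Fin 3) : Perm (Fin 6) :=
  f0 ^ (v.1 : ℕ) * f1 ^ (v.2.1 : ℕ) * f2 ^ (v.2.2.1 : ℕ) * rot ^ (v.2.2.2 : ℕ)

/-- The words `f0^a f1^b f2^c rot^k s12^e`. [folklore] -/
def word' (v : (Fin 2 × Fin 2 × Fin 2 × Fin 3) × Fin 2) : Perm (Fin 6) :=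
  word v.1 * s12 ^ (v.2 : ℕ)

/-- The 24 words `f0^a f1^b f2^c rot^k` are distinct. [folklore] -/
theorem card_words : (Finset.univ.image word).card = 24 := by decide

set_option maxRecDepth 20000 in
/-- The 48 words `f0^a f1^b f2^c rot^k s12^e` are distinct (so they exhaust `W`). [folklore] -/
theorem card_words' : (Finset.univ.image word').card = 48 := by decide

/-- A finset inside a subgroup bounds its cardinality below. [folklore] -/
theorem le_card_of_subset {M : Subgroup (Perm (Fin 6))} (S : Finset (Perm (Fin 6))) (hS : ∀ s ∈ S, s ∈ M) :
    S.card ≤ Nat.card M := by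
  have hsub : ((S : Set (Perm (Fin 6)))) ⊆ (M : Set (Perm (Fin 6))) := fun g hg => hS g hg
  have h := Set.ncard_le_ncard hsub (Set.toFinite _)
  rw [Set.ncard_coe_finset] at h
  have hc : Nat.card M = (M : Set (Perm (Fin 6))).ncard := Nat.card_coe_set_eq (M : Set (Perm (Fin 6)))
  omega

/-- A subgroup containing `f0 f1 f2 rot` has at least `24` elements. [folklore] -/
theorem words_le_card {M : Subgroup (Perm (Fin 6))} (hf0 : f0 ∈ M) (hf1 : f1 ∈ M) (hf2 : f2 ∈ M)
    (hrot : rot ∈ M) : 24 ≤ Nat.card M := by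
  rw [← card_words]
  apply le_card_of_subset
  intro s hs
  simp only [Finset.mem_image, Finset.mem_univ, true_and] at hs
  obtain ⟨v, rfl⟩ := hs
  exact M.mul_mem (M.mul_mem (M.mul_mem (M.pow_mem hf0 _) (M.pow_mem hf1 _)) (M.pow_mem hf2 _)) (M.pow_mem hrot _)

/-- A subgroup containing `f0 f1 f2 rot s12` has at least `48` elements. [folklore] -/
theorem words'_le_card {M : Subgroup (Perm (Fin 6))} (hf0 : f0 ∈ M) (hf1 : f1 ∈ M) (hf2 : f2 ∈ M)
    (hrot : rot ∈ M) (hs : s12 ∈ M) : 48 ≤ Nat.card M := by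
  rw [← card_words']
  apply le_card_of_subset
  intro s hs'
  simp only [Finset.mem_image, Finset.mem_univ, true_and] at hs'
  obtain ⟨v, rfl⟩ := hs'
  exact M.mul_mem
    (M.mul_mem (M.mul_mem (M.mul_mem (M.pow_mem hf0 _) (M.pow_mem hf1 _)) (M.pow_mem hf2 _)) (M.pow_mem hrot _))
    (M.pow_mem hs _)

/-- **No index-two subgroup of `𝒢` contains the stabiliser of `0`** (for `𝒢 ≤ W`, `cc ∈ 𝒢`, `|𝒢| ∈ {24, 48}`); by the
Galois correspondence: such a sextic CM field contains no (imaginary) quadratic subfield. [folklore] -/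
theorem no_index_two_over_stab (𝒢 : Subgroup (Perm (Fin 6))) (hW : 𝒢 ≤ W) (hc : cc ∈ 𝒢)
    (hcard : Nat.card 𝒢 = 24 ∨ Nat.card 𝒢 = 48) (M : Subgroup (Perm (Fin 6))) (hM : M ≤ 𝒢)
    (hstab : ∀ g ∈ 𝒢, g 0 = 0 → g ∈ M) (hidx : Nat.card M * 2 = Nat.card 𝒢) : False := by
  obtain ⟨-, hf1𝒢, hf2𝒢⟩ := flips_mem 𝒢 hW hc hcard
  have hf1 : f1 ∈ M := hstab f1 hf1𝒢 (by decide)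
  have hf2 : f2 ∈ M := hstab f2 hf2𝒢 (by decide)
  have hidx2 : (M.subgroupOf 𝒢).index = 2 := by
    have h1 := (M.subgroupOf 𝒢).card_mul_index
    have h2 : Nat.card (M.subgroupOf 𝒢) = Nat.card M := Nat.card_congr (Subgroup.subgroupOfEquivOfLe hM).toEquiv
    rw [h2, ← hidx] at h1
    have hpos : 0 < Nat.card M := Nat.card_pos
    exact Nat.eq_of_mul_eq_mul_left hpos h1
  have hsq : ∀ g ∈ 𝒢, g * g ∈ M := fun g hg => by
    have h := Subgroup.mul_self_mem_of_index_two hidx2 ⟨g, hg⟩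
    rwa [Subgroup.mem_subgroupOf] at h
  have hrot : rot ∈ M := by
    have h : rot = (rot * rot) * (rot * rot) := by decide
    rw [h]
    exact M.mul_mem (hsq rot (rot_mem 𝒢 hW hcard)) (hsq rot (rot_mem 𝒢 hW hcard))
  have hf0 : f0 ∈ M := by
    have h : f0 = rot * f2 * rot⁻¹ := by decide
    rw [h]
    exact M.mul_mem (M.mul_mem hrot hf2) (M.inv_mem hrot)
  have h24 : 24 ≤ Nat.card M := words_le_card hf0 hf1 hf2 hrot
  rcases hcard with h | h
  · omega
  · have hEq : 𝒢 = W := Subgroup.eq_of_le_of_card_ge hW (by rw [h, card_W])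
    have hs12 : s12 ∈ M := hstab s12 (by rw [hEq]; exact s12_mem_W) (by decide)
    have h48 : 48 ≤ Nat.card M := words'_le_card hf0 hf1 hf2 hrot hs12
    omega

set_option maxRecDepth 20000 in
/-- `|Stab_{W(B₃)}(0)| = 8` (so `[K:ℚ] = 6 = 48/8`; in the order-`24` group the stabiliser is `{1, f1, f2, f1 f2}`).
[folklore] -/
theorem card_stab_W : (Finset.univ.filter (fun g : Perm (Fin 6) => g ∈ W ∧ g 0 = 0)).card = 8 := by decide

/-! ### The two possible groups, as explicit sets of permutations -/

/-- Order `48`: `𝒢` is all of `W(B₃) = (ℤ/2)³ ⋊ 𝔖₃`. [cite: Dodson1984, §5.1.2 Theorem] -/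
theorem eq_W_of_card (𝒢 : Subgroup (Perm (Fin 6))) (hW : 𝒢 ≤ W) (h48 : Nat.card 𝒢 = 48) : 𝒢 = W :=
  Subgroup.eq_of_le_of_card_ge hW (by rw [h48, card_W])

/-- Order `24` (with `cc ∈ 𝒢`): `𝒢` is exactly `(ℤ/2)³ ⋊ ℤ/3 = {f0^a f1^b f2^c rot^k}` (24 explicit permutations).
[cite: Dodson1984, §5.1.2 Theorem] -/
theorem coe_eq_words_of_card (𝒢 : Subgroup (Perm (Fin 6))) (hW : 𝒢 ≤ W) (hc : cc ∈ 𝒢) (h24 : Nat.card 𝒢 = 24) :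
    (𝒢 : Set (Perm (Fin 6))) = ↑(Finset.univ.image word) := by
  obtain ⟨hf0, hf1, hf2⟩ := flips_mem 𝒢 hW hc (Or.inl h24)
  have hrot := rot_mem 𝒢 hW (Or.inl h24)
  symm
  apply Set.eq_of_subset_of_ncard_le _ _ (Set.toFinite _)
  · intro g hg
    simp only [Finset.coe_image, Finset.coe_univ, Set.image_univ, Set.mem_range] at hg
    obtain ⟨v, rfl⟩ := hg
    exact 𝒢.mul_mem (𝒢.mul_mem (𝒢.mul_mem (𝒢.pow_mem hf0 _) (𝒢.pow_mem hf1 _)) (𝒢.pow_mem hf2 _)) (𝒢.pow_mem hrot _)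
  · have h1 : (𝒢 : Set (Perm (Fin 6))).ncard = 24 := by rw [← Nat.card_coe_set_eq]; exact h24
    rw [h1, Set.ncard_coe_finset, card_words]

end SexticB3

end Literature.NumberTheory.ComplexMultiplication
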